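import Literature.NumberTheory.Rogawski1990.ArchTestKcBiAverage            -- ★ p827390 (F0P3-p01 (g9)): `archTestKc_biAverage_package`, `isCompact_ker_archProjUForm`
import Literature.NumberTheory.Rogawski1990.ArchTestKcConvolution          -- ★ p827148 (F0P3-p01 (g9)): `ArchTestKc.mulConv`
import Literature.NumberTheory.Rogawski1990.ArchCharactersRealReduction     -- ★ p826869 (A-p01 (g17)): `ArchTestKc.mulStar`
import Literature.NumberTheory.Automorphic.IntegratedOperator                -- ★ `ContRepresentation.integratedOperator`, `integrable_smul_apply`
import Mathlib.Analysis.Calculus.BumpFunction.FiniteDimension               -- Mathlib `exists_contDiff_tsupport_subset`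
import HarnessLib

/-!
# Dirac sequences in `ArchTestKc` and the test-function package `ArchTestKcPackage` of the T1 arch line
# (Labesse–Langlands 1979, Lemma 6.1 p. 768: «`B` is closed under `f → f^*` and under the obvious convolution product», «`B` ample»;
# Jacquet–Langlands 1970, Lemma 16.1.1 (proof) p. 498; Rogawski 1990 §14.2 p. 233)

Topic `NumberTheory/Rogawski1990`; namespace `Literature.NumberTheory.Rogawski1990` (home of ★ `ArchTestKc`).  KERNEL ONLY: theorems, 0 definitions,
0 named facts, 0 `sorry`, no instance, no notation.  Cell `hodgecm-mathlib`, floor 0, programme P3, typer topic T1, crux H413 (`stmt-HodgeConjecture-24833`);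
the ARCH line `Cruxes/H413/Lines/F0_T1a_ArchCharactersLinIndep.lean` (REGISTERED b8fa30127498) §0 sub-goal (β) `ArchTestKcPackage` of its last open stub
`stub_archAssembly`.  Seat F0P3b-p01 (g0) (LEAD of `stub_archAssembly`).  HONEST LABEL: HC_CM is proved only modulo the printed citations until rung 0 closes;
this file discharges the in-house sub-goal (β), no printed theorem.

THE MATHEMATICS.  `G′_∞ = U(H)(L⁺ ⊗ ℝ) ≤ GL₃(L ⊗ ℝ)` (★ `UnitaryGroup.arch`), `K_c := ker (archProjUForm) ≤ G′_∞` the compact archimedean factor away from `ι`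
(compact under the frame guard `hdef`, ★ `isCompact_ker_archProjUForm`), `νinf` a Haar measure on `G′_∞`.
* §1 SMOOTH BUMPS AT `1` ON `GL₃(L ⊗ ℝ)` INSIDE ANY NEIGHBOURHOOD (Mathlib `exists_contDiff_tsupport_subset` on `M₃(L ⊗ ℝ)`, `Units.val` an open embedding):
  real, `≥ 0`, `= 1` at `1`, continuous, compactly supported, arch-smooth after complexification (★ `IsArchTestFunction.isArchSmooth_of_contDiff_slice`).
* §2 A DIRAC SEQUENCE ON `G′_∞` MADE OF RESTRICTIONS OF SUCH BUMPS (the three clauses of ★ `IsDiracSequence νinf`: real `≥ 0`, mass `1`, supports eventually in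
  every neighbourhood of `1`): restrict along the closed subgroup (★ `isClosed_arch`), normalise by the `νinf`-mass (positive: `νinf` charges open sets and the bump
  is `1` at `1`), supports shrink because `G′_∞` carries the subspace topology (a countable neighbourhood basis of `1` in `G′_∞` is refined by traces of
  `GL₃`-neighbourhoods); and the strong limit `π(φₙ) v → v` along such a sequence (the proof of ★ `IsDiracSequence.tendsto_integratedOperator_apply`, restated on
  the three clauses because that module's olean is not served by the farm at filing time).  [DeitmarEchterhoff2014, §1.6, Lemma 6.2.2; Borel1972, 3.4]
* §3 SUB-GOAL (β)(c) — A DIRAC SEQUENCE IN `ArchTestKc`: replace each member by its bi-`K_c`-average (★ p827390 `archTestKc_biAverage_package`: in `ArchTestKc`,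
  SAME integrated operator on every unitary globalization pulled back along `archProjUForm`, these being trivial on `K_c = ker`), and conclude with §2
  (`π(φₙ) v → v`, [DeitmarEchterhoff2014, Lemma 6.2.2]).  Statement = conjunct (c) of `ArchTestKcPackage` TOKEN FOR TOKEN under its `letI := borel _`, its
  guard `hdef` and its `hν`.
* §4 SUB-GOAL (β) — THE WHOLE PACKAGE `archTestKc_package`: (a) ★ `ArchTestKc.mulStar` (p826869) + ★ `ArchTestKc.mulConv` (p827148), (b) ★ p827390, (c) §3 — the
  BODY of `def ArchTestKcPackage` of the Lines file TOKEN FOR TOKEN (so that the Lines fold is `archTestKcPackage_holds : ArchTestKcPackage := archTestKc_package`).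
[LabesseLanglands1979, Lemma 6.1 p. 768]; [JacquetLanglands1970, Lemma 16.1.1 (proof) p. 498]; [Rogawski1990, §14.2 p. 233]; [DeitmarEchterhoff2014, §1.6, Lemma 6.2.2];
[Borel1972, 3.4].

## References
* J.-P. Labesse, R. P. Langlands, *L-indistinguishability for SL(2)*, Canad. J. Math. 31 (1979), Lemma 6.1 p. 768 [LabesseLanglands1979].
* H. Jacquet, R. P. Langlands, *Automorphic Forms on GL(2)*, LNM 114 (1970), Lemma 16.1.1 (proof) p. 498 [JacquetLanglands1970].
* J. D. Rogawski, *Automorphic Representations of Unitary Groups in Three Variables* (1990), §14.2 p. 233 [Rogawski1990].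
* A. Deitmar, S. Echterhoff, *Principles of Harmonic Analysis*, 2nd ed. (2014), §1.6 (Dirac functions), Lemma 6.2.2 [DeitmarEchterhoff2014].
* A. Borel, *Représentations de groupes localement compacts*, LNM 276 (1972), 3.4 (Dirac sequences of smooth bumps) [Borel1972].
-/

set_option autoImplicit false

noncomputable section

open NumberField NumberField.mixedEmbedding IsDedekindDomain MeasureTheory Measure Set Filter Topology CompactlySupported
-- `Classical`: the place subtypes indexing `mixedSpace L` are `Fintype` classically (`NormedCommRing (mixedSpace L)`); `Matrix.Norms.Operator`: the normed ring
-- `M₃(L ⊗ ℝ)` (through which ★ `IsArchSmooth` is defined); `ContDiff`: the exponent `∞`; `ComplexOrder`: `Matrix.PosDef` over `ℂ` (the frame guard `hdef`).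
open scoped Matrix ComplexConjugate Classical ContDiff Matrix.Norms.Operator Topology ComplexOrder

namespace Literature.NumberTheory.Rogawski1990

open Literature.NumberTheory.Automorphic Literature.NumberTheory.Automorphic.UnitaryGroup
open Literature.NumberTheory.Automorphic.UnitaryGroup.CotangentForms
open Literature.RepresentationTheory.KonnoKonno2007

variable (L : Type) [Field L] [NumberField L] [IsCMField L] (ι : L →+* ℂ) (H : Matrix (Fin 3) (Fin 3) L) (T : GL (Fin 3) ℂ)
  (hT : (T : Matrix (Fin 3) (Fin 3) ℂ)ᴴ * H.map ι * (T : Matrix (Fin 3) (Fin 3) ℂ) = Literature.Geometry.ComplexHyperbolic.BallModel.J)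

/-! ## §1 Smooth bumps at `1` on `GL₃(L ⊗ ℝ)` inside a given neighbourhood -/

section Bump

-- the scoped `L∞`-operator normed ring structure on matrices is only reducibly defeq to the Pi uniformity (as in ★ `ArchGardingWhittaker`,
-- ★ `GLnCuspidalSpectrumSiegelProofs`, ★ `PairLFunctionPolesEqConjArch.exists_archBump`)
set_option backward.isDefEq.respectTransparency false in
omit [IsCMField L] in
/-- **Smooth bumps at `1` on `GL₃(L ⊗ ℝ)` inside any neighbourhood `V` of `1`**: a real `β ≥ 0` on `GL₃(L ⊗ ℝ)`, continuous, compactly supported, `β 1 = 1`,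
`support β ⊆ V`, whose complexification is smooth in the archimedean variable (★ `IsArchSmooth` for ★ `archGroupGL 3 L`) — the restriction along the open embedding
`Units.val` of a smooth Urysohn function on `M₃(L ⊗ ℝ)` (Mathlib `exists_contDiff_tsupport_subset`); the exponential slices `M ↦ β(g e^M)` are smooth by the chain
rule (★ `Literature.Analysis.Calculus.contDiffAt_exp`). [cite: Borel1972, 3.4] -/
theorem exists_archSmoothBump_support_subset {V : Set (GL (Fin 3) (mixedSpace L))} (hV : V ∈ 𝓝 (1 : GL (Fin 3) (mixedSpace L))) :
    ∃ β : GL (Fin 3) (mixedSpace L) → ℝ, Continuous β ∧ HasCompactSupport β ∧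
      IsArchSmooth (archGroupGL 3 L).carrier.subtype (fun u => ((β u : ℝ) : ℂ)) ∧
      (∀ u, 0 ≤ β u) ∧ β 1 = 1 ∧ Function.support β ⊆ V := by
  -- `M₃(L ⊗ ℝ)` is finite-dimensional over `ℝ` (Mathlib `Module.Finite.matrix`, put in the context: under the scoped `Matrix.Norms.Operator` structure the
  -- synthesised instance term exceeds `synthInstance.maxSize`, cf. ★ `finiteDimensional_matrix_mixedSpace` of `GLnCuspidalSpectrumSiegelProofs`)
  haveI : FiniteDimensional ℝ (Matrix (Fin 3) (Fin 3) (mixedSpace L)) := Module.Finite.matrix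
  have hW : (Units.val '' V) ∈ 𝓝 (1 : Matrix (Fin 3) (Fin 3) (mixedSpace L)) := by
    have h := (Units.isOpenEmbedding_val (R := Matrix (Fin 3) (Fin 3) (mixedSpace L))).image_mem_nhds.2 hV
    rwa [Units.val_one] at h
  obtain ⟨ψ, hψsupp, hψcpt, hψsmooth, hψrange, hψ1⟩ := exists_contDiff_tsupport_subset (n := ⊤) hW
  have hsupp : Function.support (fun u : GL (Fin 3) (mixedSpace L) => ψ u) ⊆ V := fun u hu => by
    obtain ⟨u', hu', he⟩ := hψsupp (subset_tsupport _ (Function.mem_support.2 (Function.mem_support.1 hu)))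
    rwa [← Units.ext he]
  have hcs : HasCompactSupport (fun u : GL (Fin 3) (mixedSpace L) => ψ u) :=
    HasCompactSupport.of_support_subset_isCompact
      ((Units.isOpenEmbedding_val (R := Matrix (Fin 3) (Fin 3) (mixedSpace L))).isInducing.isCompact_preimage' hψcpt
        (hψsupp.trans (image_subset_range _ _)))
      fun u hu => subset_tsupport _ hu
  have hexp : ContDiff ℝ ∞ (NormedSpace.exp : Matrix (Fin 3) (Fin 3) (mixedSpace L) → Matrix (Fin 3) (Fin 3) (mixedSpace L)) :=
    contDiff_iff_contDiffAt.2 fun x => Literature.Analysis.Calculus.contDiffAt_exp x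
  refine ⟨fun u => ψ u, hψsmooth.continuous.comp Units.continuous_val, hcs,
    IsArchTestFunction.isArchSmooth_of_contDiff_slice fun g => ?_, fun u => (hψrange ⟨_, rfl⟩).1, by simpa only [Units.val_one] using hψ1,
    hsupp⟩
  -- the slice `M ↦ ψ(g e^M)` through `M₃(L ⊗ ℝ)`
  have h1 : ContDiff ℝ ∞ fun M : Matrix (Fin 3) (Fin 3) (mixedSpace L) => ψ ((g : Matrix (Fin 3) (Fin 3) (mixedSpace L)) * NormedSpace.exp M) :=
    hψsmooth.comp (contDiff_const.mul hexp)
  have h2 : (fun M : Matrix (Fin 3) (Fin 3) (mixedSpace L) => ((ψ ((g * expGL M : GL (Fin 3) (mixedSpace L)) : Matrix (Fin 3) (Fin 3) (mixedSpace L)) : ℝ) : ℂ)) =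
      fun M => ((ψ ((g : Matrix (Fin 3) (Fin 3) (mixedSpace L)) * NormedSpace.exp M) : ℝ) : ℂ) := by
    funext M
    rw [Units.val_mul, coe_expGL]
  rw [h2]
  exact Complex.ofRealCLM.contDiff.comp h1

end Bump

/-! ## §2 A Dirac sequence on `G′_∞` made of restrictions of smooth bumps, and `π(φₙ) v → v` -/

section DiracLimit

/-- **`π(φₙ) v → v` along a Dirac sequence** (Deitmar–Echterhoff (2014), Lemma 6.2.2: «for every Dirac net `(φ_U)_U` the net `(π(φ_U) v)` converges to `v` in the
norm topology»), for a unitary strongly continuous representation `π` on a Hilbert space and a measure finite on compact sets, the Dirac sequence being given by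
its three clauses (real `≥ 0`, `η`-mass `1`, topological supports eventually inside every neighbourhood of `1`): `‖π(φₙ) v - v‖ = ‖∫ φₙ(g) (π(g) v - v) dη‖ ≤
sup_{g ∈ supp φₙ} ‖π(g) v - v‖`, small once `supp φₙ ⊆ {g : ‖π(g) v - v‖ < ε}`, a neighbourhood of `1` by strong continuity.  (This is the proof of ★
`IsDiracSequence.tendsto_integratedOperator_apply` of `IntegratedOperatorDiracSequence`, restated on the clauses.) [cite: DeitmarEchterhoff2014, Lemma 6.2.2] -/
theorem tendsto_integratedOperator_apply_of_dirac {G E : Type*} [Group G] [TopologicalSpace G] [MeasurableSpace G] [OpensMeasurableSpace G]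
    [NormedAddCommGroup E] [InnerProductSpace ℂ E] [CompleteSpace E]
    {π : ContRepresentation ℂ G E} {η : Measure G} [IsFiniteMeasureOnCompacts η] {φ : ℕ → C_c(G, ℂ)}
    (hre : ∀ n g, 0 ≤ (φ n g).re ∧ (φ n g).im = 0) (hone : ∀ n, ∫ g, (φ n g).re ∂η = 1)
    (hsupp : ∀ U ∈ 𝓝 (1 : G), ∀ᶠ n in atTop, tsupport (φ n) ⊆ U)
    (hu : π.IsUnitary) (hc : π.IsStronglyContinuous) (v : E) :
    Tendsto (fun n => π.integratedOperator hu hc η (φ n) v) atTop (𝓝 v) := by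
  have hcoe : ∀ n g, (φ n g : ℂ) = ((φ n g).re : ℂ) := fun n g => Complex.ext (by simp) (by simp [(hre n g).2])
  have hnorm : ∀ n g, ‖φ n g‖ = (φ n g).re := fun n g => by
    rw [hcoe n g, Complex.norm_real, Real.norm_of_nonneg (hre n g).1, Complex.ofReal_re]
  have hone' : ∀ n, ∫ g, (φ n g : ℂ) ∂η = 1 := fun n => by
    rw [integral_congr_ae (Eventually.of_forall fun g => hcoe n g), integral_complex_ofReal, hone n, Complex.ofReal_one]
  rw [Metric.tendsto_atTop]
  intro ε hε
  -- the neighbourhood `U = {g : ‖π(g) v - v‖ < ε / 2}` of `1`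
  set U : Set G := {g | ‖π g v - v‖ < ε / 2} with hU
  have hUo : IsOpen U := isOpen_lt ((hc v).sub continuous_const).norm continuous_const
  have h1U : (1 : G) ∈ U := by
    change ‖π 1 v - v‖ < ε / 2
    rw [map_one]
    change ‖v - v‖ < ε / 2
    rw [sub_self, norm_zero]
    exact half_pos hε
  obtain ⟨N, hN⟩ := eventually_atTop.mp (hsupp U (hUo.mem_nhds h1U))
  refine ⟨N, fun n hn => ?_⟩
  rw [dist_eq_norm]
  -- `∫ φₙ(g) • v = v`
  have hint2 : Integrable (fun g => φ n g • v) η :=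
    ((φ n).continuous.smul continuous_const).integrable_of_hasCompactSupport
      ((φ n).hasCompactSupport.smul_right : HasCompactSupport ((⇑(φ n)) • fun _ : G => v))
  have hcv : ∫ g, φ n g • v ∂η = v := by
    rw [integral_smul_const, hone' n, one_smul]
  have hint : Integrable (fun g => (φ n g).re * (ε / 2)) η :=
    ((Complex.continuous_re.comp (φ n).continuous).integrable_of_hasCompactSupport
      ((φ n).hasCompactSupport.comp_left Complex.zero_re)).mul_const _
  -- the estimate `‖π(φₙ) v - v‖ ≤ ∫ φₙ · ε / 2 = ε / 2`
  have hest : ‖π.integratedOperator hu hc η (φ n) v - v‖ ≤ ε / 2 := by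
    have hsub : π.integratedOperator hu hc η (φ n) v - v = ∫ g, (φ n g • π g v - φ n g • v) ∂η := by
      rw [integral_sub (ContRepresentation.integrable_smul_apply hc η (φ n) v) hint2, hcv, ContRepresentation.integratedOperator_apply]
    rw [hsub]
    calc ‖∫ g, (φ n g • π g v - φ n g • v) ∂η‖ ≤ ∫ g, (φ n g).re * (ε / 2) ∂η := by
          refine norm_integral_le_of_norm_le hint (Eventually.of_forall fun g => ?_)
          rw [← smul_sub, _root_.norm_smul, hnorm n g]
          by_cases hg : g ∈ U
          · exact mul_le_mul_of_nonneg_left hg.le (hre n g).1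
          · have hg' : g ∉ tsupport (φ n) := fun h' => hg (hN n hn h')
            rw [image_eq_zero_of_notMem_tsupport hg']
            simp
      _ = ε / 2 := by rw [integral_mul_const, hone n, one_mul]
  exact lt_of_le_of_lt hest (half_lt_self hε)

end DiracLimit

section Dirac

variable {L H}

omit ι T hT in
/-- **A Dirac sequence on `G′_∞ = U(H)(L⁺ ⊗ ℝ)` with smooth compactly supported models on `GL₃(L ⊗ ℝ)`**: for a measure `ν` on `G′_∞` finite on compacta and
positive on non-empty open sets (a Haar measure) there is `ψ : ℕ → C_c(G′_∞, ℂ)`, real `≥ 0`, of `ν`-mass `1`, with topological supports eventually inside every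
neighbourhood of `1` (the clauses of ★ `IsDiracSequence ν ψ`), each of whose members is the restriction of a continuous compactly supported arch-smooth function on
`GL₃(L ⊗ ℝ)` — the bumps of §1 in `GL₃`-neighbourhoods tracing a countable basis of neighbourhoods of `1` in `G′_∞`, restricted along the closed subgroup
(★ `isClosed_arch`) and normalised by their (positive) `ν`-mass. [cite: Borel1972, 3.4] [cite: DeitmarEchterhoff2014, §1.6] -/
theorem exists_dirac_archSmooth [MeasurableSpace (UnitaryGroup.arch (↥(maximalRealSubfield L)) L (IsCMField.complexConj L) 3 H)]
    [BorelSpace (UnitaryGroup.arch (↥(maximalRealSubfield L)) L (IsCMField.complexConj L) 3 H)]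
    (ν : Measure (UnitaryGroup.arch (↥(maximalRealSubfield L)) L (IsCMField.complexConj L) 3 H)) [IsFiniteMeasureOnCompacts ν] [ν.IsOpenPosMeasure] :
    ∃ ψ : ℕ → C_c(UnitaryGroup.arch (↥(maximalRealSubfield L)) L (IsCMField.complexConj L) 3 H, ℂ),
      (∀ m k, 0 ≤ (ψ m k).re ∧ (ψ m k).im = 0) ∧ (∀ m, ∫ k, (ψ m k).re ∂ν = 1) ∧
      (∀ U ∈ 𝓝 (1 : UnitaryGroup.arch (↥(maximalRealSubfield L)) L (IsCMField.complexConj L) 3 H), ∀ᶠ m in atTop, tsupport (ψ m) ⊆ U) ∧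
      ∀ m, ∃ ψ' : GL (Fin 3) (mixedSpace L) → ℂ, Continuous ψ' ∧ HasCompactSupport ψ' ∧
        IsArchSmooth (archGroupGL 3 L).carrier.subtype ψ' ∧
        ∀ k : UnitaryGroup.arch (↥(maximalRealSubfield L)) L (IsCMField.complexConj L) 3 H, ψ m k = ψ' (k : GL (Fin 3) (mixedSpace L)) := by
  -- a countable basis `u` of neighbourhoods of `1` in `G′_∞`, refined by traces of `GL₃`-neighbourhoods `V m`
  obtain ⟨u, hu⟩ := (𝓝 (1 : UnitaryGroup.arch (↥(maximalRealSubfield L)) L (IsCMField.complexConj L) 3 H)).exists_antitone_basis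
  have hV : ∀ m, ∃ V ∈ 𝓝 (1 : GL (Fin 3) (mixedSpace L)),
      ((fun k : UnitaryGroup.arch (↥(maximalRealSubfield L)) L (IsCMField.complexConj L) 3 H => (k : GL (Fin 3) (mixedSpace L))) ⁻¹' V) ⊆ u m := fun m => by
    have hm : u m ∈ 𝓝 (1 : UnitaryGroup.arch (↥(maximalRealSubfield L)) L (IsCMField.complexConj L) 3 H) := hu.1.mem_of_mem trivial
    rw [Topology.IsInducing.subtypeVal.nhds_eq_comap, OneMemClass.coe_one, mem_comap] at hm
    exact hm
  choose V hV1 hVu using hV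
  -- smooth bumps inside `V m`, restricted to `G′_∞`
  choose β hβc hβs hβsm hβ0 hβ1 hβV using fun m => exists_archSmoothBump_support_subset L (hV1 m)
  set a : ℕ → UnitaryGroup.arch (↥(maximalRealSubfield L)) L (IsCMField.complexConj L) 3 H → ℝ := fun m k => β m (k : GL (Fin 3) (mixedSpace L)) with ha
  have ha_cont : ∀ m, Continuous (a m) := fun m => (hβc m).comp continuous_subtype_val
  have ha_cs : ∀ m, HasCompactSupport (a m) := fun m =>
    (hβs m).comp_isClosedEmbedding
      (Topology.IsClosedEmbedding.subtypeVal (isClosed_arch (↥(maximalRealSubfield L)) L (IsCMField.complexConj L) 3 H))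
  have ha_nonneg : ∀ m k, 0 ≤ a m k := fun m k => hβ0 m _
  have ha_one : ∀ m, a m 1 ≠ 0 := fun m => by
    simp only [ha, OneMemClass.coe_one, hβ1 m]
    exact one_ne_zero
  -- the masses `c m = ∫ a m dν > 0`
  set c : ℕ → ℝ := fun m => ∫ k, a m k ∂ν with hc_def
  have hc : ∀ m, 0 < c m := fun m =>
    (ha_cont m).integral_pos_of_hasCompactSupport_nonneg_nonzero (ha_cs m) (fun k => ha_nonneg m k) (ha_one m)
  -- the normalised restrictions, complexified and bundled
  have hψc : ∀ m, Continuous fun k : UnitaryGroup.arch (↥(maximalRealSubfield L)) L (IsCMField.complexConj L) 3 H => (((c m)⁻¹ * a m k : ℝ) : ℂ) :=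
    fun m => Complex.continuous_ofReal.comp (continuous_const.mul (ha_cont m))
  have hψs : ∀ m, HasCompactSupport fun k : UnitaryGroup.arch (↥(maximalRealSubfield L)) L (IsCMField.complexConj L) 3 H => (((c m)⁻¹ * a m k : ℝ) : ℂ) :=
    fun m => ((ha_cs m).mul_left (f := fun _ => (c m)⁻¹)).comp_left Complex.ofReal_zero
  let ψ : ℕ → C_c(UnitaryGroup.arch (↥(maximalRealSubfield L)) L (IsCMField.complexConj L) 3 H, ℂ) := fun m => ⟨⟨_, hψc m⟩, hψs m⟩
  have hψ_apply : ∀ m k, ψ m k = (((c m)⁻¹ * a m k : ℝ) : ℂ) := fun m k => rfl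
  refine ⟨ψ, fun m k => ?_, fun m => ?_, fun U hU => ?_, fun m => ?_⟩
  · -- real and non-negative
    rw [hψ_apply, Complex.ofReal_re, Complex.ofReal_im]
    exact ⟨mul_nonneg (inv_nonneg.2 (hc m).le) (ha_nonneg m k), rfl⟩
  · -- mass one
    simp only [hψ_apply, Complex.ofReal_re]
    rw [integral_const_mul]
    exact inv_mul_cancel₀ (hc m).ne'
  · -- the supports shrink into `U`: through a closed neighbourhood `U' ⊆ U` and the basis `u`
    obtain ⟨U', hU', hU'c, hU'U⟩ := exists_mem_nhds_isClosed_subset hU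
    obtain ⟨i, -, hi⟩ := hu.1.mem_iff.1 hU'
    refine eventually_atTop.2 ⟨i, fun m hm => (closure_minimal (fun k hk => ?_) hU'c).trans hU'U⟩
    have hk' : a m k ≠ 0 := by
      rw [Function.mem_support, hψ_apply, Complex.ofReal_ne_zero] at hk
      exact right_ne_zero_of_mul hk
    exact hi (hu.2 hm (hVu m (hβV m hk')))
  · -- the smooth model `(c m)⁻¹ • β m` on `GL₃(L ⊗ ℝ)`
    have ht : IsArchTestFunction 3 L ((((c m)⁻¹ : ℝ) : ℂ) • fun u : GL (Fin 3) (mixedSpace L) => ((β m u : ℝ) : ℂ)) :=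
      (IsArchTestFunction.of_real (hβc m) (hβs m) (hβsm m)).smul _
    refine ⟨_, ht.continuous, ht.hasCompactSupport, ht.isArchSmooth, fun k => ?_⟩
    rw [hψ_apply, Pi.smul_apply, smul_eq_mul, Complex.ofReal_mul]

end Dirac

/-! ## §3 Sub-goal (β)(c): a Dirac sequence in `ArchTestKc` for the `K_c`-trivial unitary globalizations -/

section Package

/-- **(β)(c) — a Dirac sequence in `ArchTestKc`**: under the frame guard `hdef` (`K_c` compact) and for a Haar measure `νinf` on `G′_∞` there are `φₙ ∈ ArchTestKc` with
`(ϖ ∘ archProjUForm)(φₙ) v → v` for every unitary globalization `ϖ` of every class `x ∈ Cinf` and every vector `v` — the bi-`K_c`-averages (★ `archTestKc_biAverage_package`,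
same integrated operator since `ϖ ∘ archProjUForm` kills `K_c = ker`) of the smooth Dirac sequence of §2, by §2's `π(φₙ) v → v`
[DeitmarEchterhoff2014, Lemma 6.2.2].  The statement is conjunct (c) of `ArchTestKcPackage` (§0 of the T1 arch line) token for token, under its `letI := borel _`, its
guard `hdef` and its `hν` («`B` ample»: JL p. 498 uses the non-degeneracy this supplies). [cite: LabesseLanglands1979, Lemma 6.1 p. 768]
[cite: JacquetLanglands1970, Lemma 16.1.1 (proof) p. 498] [cite: DeitmarEchterhoff2014, Lemma 6.2.2] -/
theorem archTestKc_dirac_package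
    (νinf : @Measure (UnitaryGroup.arch (↥(maximalRealSubfield L)) L (IsCMField.complexConj L) 3 H) (borel _))
    (hdef : ∀ τ' : L →+* ℂ, InfinitePlace.mk τ' ≠ InfinitePlace.mk ι → (H.map τ').PosDef)
    (hν : @Measure.IsHaarMeasure _ _ _ (borel _) νinf) :
    letI : MeasurableSpace (UnitaryGroup.arch (↥(maximalRealSubfield L)) L (IsCMField.complexConj L) 3 H) := borel _
    haveI : BorelSpace (UnitaryGroup.arch (↥(maximalRealSubfield L)) L (IsCMField.complexConj L) 3 H) := ⟨rfl⟩
    ∃ (φn : ℕ → UnitaryGroup.arch (↥(maximalRealSubfield L)) L (IsCMField.complexConj L) 3 H → ℂ) (hφn : ∀ n, ArchTestKc L ι H T hT (φn n)),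
      ∀ (x : GKIrrClass (uFormGroup (Fin 2) (Fin 1)))
        (E : Type) [NormedAddCommGroup E] [InnerProductSpace ℂ E] [CompleteSpace E]
        (ϖ : ContRepresentation ℂ (uFormGroup (Fin 2) (Fin 1)).carrier E) (hϖ : IsUnitaryGlobalization (uFormGroup (Fin 2) (Fin 1)) x ϖ) (v : E),
        Tendsto (fun n => (ϖ.restrict (archProjUForm L ι H T hT)).integratedOperator (hϖ.isUnitary.restrict _)
            (hϖ.isStronglyContinuous.restrict _ (continuous_archProjUForm L ι H T hT)) νinf
            ⟨⟨φn n, (hφn n).continuous⟩, (hφn n).hasCompactSupport⟩ v) atTop (𝓝 v) := by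
  letI : MeasurableSpace (UnitaryGroup.arch (↥(maximalRealSubfield L)) L (IsCMField.complexConj L) 3 H) := borel _
  haveI : BorelSpace (UnitaryGroup.arch (↥(maximalRealSubfield L)) L (IsCMField.complexConj L) 3 H) := ⟨rfl⟩
  haveI := hν
  -- the smooth Dirac sequence of §2 and its bi-`K_c`-averages (★ p827390)
  obtain ⟨ψ, hre, hone, hsupp, hmod⟩ := exists_dirac_archSmooth (L := L) (H := H) νinf
  have hb := archTestKc_biAverage_package L ι H T hT νinf hdef hν
  choose φn hφn hφeq using fun m => hb (ψ m) (ψ m).continuous (ψ m).hasCompactSupport (hmod m)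
  refine ⟨φn, hφn, fun x E _ _ _ ϖ hϖ v => ?_⟩
  refine (tendsto_integratedOperator_apply_of_dirac (π := ϖ.restrict (archProjUForm L ι H T hT)) hre hone hsupp (hϖ.isUnitary.restrict _)
    (hϖ.isStronglyContinuous.restrict _ (continuous_archProjUForm L ι H T hT)) v).congr fun n => ?_
  rw [hφeq n x E ϖ hϖ]
  rfl

/-! ## §4 Sub-goal (β): the package `ArchTestKcPackage` of the T1 arch line, assembled -/

/-- **SUB-GOAL (β) OF `stub_archAssembly` — THE TEST-FUNCTION PACKAGE `ArchTestKcPackage` (A9) ASSEMBLED**: at every CM frame `(L, ι, H, T)` with guard (`K_c` compact)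
and every Haar measure `νinf` on `G′_∞`: (a) `ArchTestKc` is closed under ★ `mulStar` (★ p826869 `ArchTestKc.mulStar`, A-p01 (g17)) and under ★ `mulConv νinf`
(★ p827148 `ArchTestKc.mulConv`, F0P3-p01 (g9)); (b) every continuous compactly supported `ψ` with a smooth model on `GL₃(L ⊗ ℝ)` has a bi-`K_c`-average in
`ArchTestKc` with the same integrated operator on every pulled-back unitary globalization (★ p827390 `archTestKc_biAverage_package`, F0P3-p01 (g9)); (c) a Dirac
sequence in `ArchTestKc` for all such representations (§3).  The statement is the BODY of `def ArchTestKcPackage` (§0 of `Cruxes/H413/Lines/F0_T1a_ArchCharactersLinIndep.lean`,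
typ-T1b «=» 2026-08-31T15:00:27Z) TOKEN FOR TOKEN, so that the Lines fold reads `theorem archTestKcPackage_holds : ArchTestKcPackage := archTestKc_package`.
«`B` is closed under `f → f^*` and under the obvious convolution product», «`B` ample». [cite: LabesseLanglands1979, Lemma 6.1 p. 768]
[cite: JacquetLanglands1970, Lemma 16.1.1 (proof) p. 498] [cite: Rogawski1990, §14.2 p. 233] -/
theorem archTestKc_package :
    ∀ (L : Type) [Field L] [NumberField L] [IsCMField L] (ι : L →+* ℂ) (H : Matrix (Fin 3) (Fin 3) L) (T : GL (Fin 3) ℂ)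
    (hT : (T : Matrix (Fin 3) (Fin 3) ℂ)ᴴ * H.map ι * (T : Matrix (Fin 3) (Fin 3) ℂ) = Literature.Geometry.ComplexHyperbolic.BallModel.J)
    (νinf : @Measure (UnitaryGroup.arch (↥(maximalRealSubfield L)) L (IsCMField.complexConj L) 3 H) (borel _)),
    letI : MeasurableSpace (UnitaryGroup.arch (↥(maximalRealSubfield L)) L (IsCMField.complexConj L) 3 H) := borel _
    haveI : BorelSpace (UnitaryGroup.arch (↥(maximalRealSubfield L)) L (IsCMField.complexConj L) 3 H) := ⟨rfl⟩
    (∀ τ' : L →+* ℂ, InfinitePlace.mk τ' ≠ InfinitePlace.mk ι → (H.map τ').PosDef) →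
    ∀ (_hν : νinf.IsHaarMeasure),
      -- (a) `*`-algebra
      (∀ φ : UnitaryGroup.arch (↥(maximalRealSubfield L)) L (IsCMField.complexConj L) 3 H → ℂ, ArchTestKc L ι H T hT φ →
          ArchTestKc L ι H T hT (mulStar φ) ∧
          ∀ ψ : UnitaryGroup.arch (↥(maximalRealSubfield L)) L (IsCMField.complexConj L) 3 H → ℂ, ArchTestKc L ι H T hT ψ →
            ArchTestKc L ι H T hT (mulConv νinf φ ψ)) ∧
      -- (b) bi-`K_c`-average with the same operator on `K_c`-trivial representations
      (∀ ψ : UnitaryGroup.arch (↥(maximalRealSubfield L)) L (IsCMField.complexConj L) 3 H → ℂ, ∀ (hψc : Continuous ψ) (hψs : HasCompactSupport ψ),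
          (∃ ψ' : GL (Fin 3) (NumberField.mixedEmbedding.mixedSpace L) → ℂ, Continuous ψ' ∧ HasCompactSupport ψ' ∧
              IsArchSmooth (archGroupGL 3 L).carrier.subtype ψ' ∧
              ∀ k : UnitaryGroup.arch (↥(maximalRealSubfield L)) L (IsCMField.complexConj L) 3 H,
                ψ k = ψ' (k : GL (Fin 3) (NumberField.mixedEmbedding.mixedSpace L))) →
          ∃ (ψn : UnitaryGroup.arch (↥(maximalRealSubfield L)) L (IsCMField.complexConj L) 3 H → ℂ) (hψn : ArchTestKc L ι H T hT ψn),
            ∀ (x : GKIrrClass (uFormGroup (Fin 2) (Fin 1)))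
              (E : Type) [NormedAddCommGroup E] [InnerProductSpace ℂ E] [CompleteSpace E]
              (ϖ : ContRepresentation ℂ (uFormGroup (Fin 2) (Fin 1)).carrier E) (hϖ : IsUnitaryGlobalization (uFormGroup (Fin 2) (Fin 1)) x ϖ),
              (ϖ.restrict (archProjUForm L ι H T hT)).integratedOperator (hϖ.isUnitary.restrict _)
                  (hϖ.isStronglyContinuous.restrict _ (continuous_archProjUForm L ι H T hT)) νinf ⟨⟨ψn, hψn.continuous⟩, hψn.hasCompactSupport⟩ =
                (ϖ.restrict (archProjUForm L ι H T hT)).integratedOperator (hϖ.isUnitary.restrict _)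
                  (hϖ.isStronglyContinuous.restrict _ (continuous_archProjUForm L ι H T hT)) νinf ⟨⟨ψ, hψc⟩, hψs⟩) ∧
      -- (c) Dirac sequence in `ArchTestKc` for the `K_c`-trivial unitary globalizations
      (∃ (φn : ℕ → UnitaryGroup.arch (↥(maximalRealSubfield L)) L (IsCMField.complexConj L) 3 H → ℂ) (hφn : ∀ n, ArchTestKc L ι H T hT (φn n)),
          ∀ (x : GKIrrClass (uFormGroup (Fin 2) (Fin 1)))
            (E : Type) [NormedAddCommGroup E] [InnerProductSpace ℂ E] [CompleteSpace E]
            (ϖ : ContRepresentation ℂ (uFormGroup (Fin 2) (Fin 1)).carrier E) (hϖ : IsUnitaryGlobalization (uFormGroup (Fin 2) (Fin 1)) x ϖ) (v : E),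
            Tendsto (fun n => (ϖ.restrict (archProjUForm L ι H T hT)).integratedOperator (hϖ.isUnitary.restrict _)
                (hϖ.isStronglyContinuous.restrict _ (continuous_archProjUForm L ι H T hT)) νinf
                ⟨⟨φn n, (hφn n).continuous⟩, (hφn n).hasCompactSupport⟩ v) atTop (𝓝 v)) := by
  intro L _ _ _ ι H T hT νinf
  letI : MeasurableSpace (UnitaryGroup.arch (↥(maximalRealSubfield L)) L (IsCMField.complexConj L) 3 H) := borel _
  haveI : BorelSpace (UnitaryGroup.arch (↥(maximalRealSubfield L)) L (IsCMField.complexConj L) 3 H) := ⟨rfl⟩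
  intro hdef hν
  exact ⟨fun φ hφ => ⟨hφ.mulStar, fun ψ hψ => ArchTestKc.mulConv L ι H T hT νinf hν hφ hψ⟩,
    archTestKc_biAverage_package L ι H T hT νinf hdef hν, archTestKc_dirac_package L ι H T hT νinf hdef hν⟩

end Package

end Literature.NumberTheory.Rogawski1990

end
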